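import Summits.AtomisticToContinuum.Crystallization.Theorems.PerronTransitivityUniformBindingRigidityCohesionG

/-!
# Cohesion of uniformly bound Lennard-Jones configurations, VIII: the `e*`-free core

Helper file (`--supports stmt-AtomisticToContinuum-15099`) of the stub
`stub_noThickHalfSpaceBinding` of the line `registered` (skeleton
`Cruxes/UniformBindingRigidity/Lines/birth.lean`, rev 2) of the crux
`Summit.AtomisticToContinuum.Crystallization.Theses.PerronTransitivity.UniformBindingRigidity`
(item stmt-AtomisticToContinuum-15099).  After parts I–VII (`…Cohesion{A,…,G}.lean`) the stub IS
the open core `(NHB-thick)`: a `1/4`-separated `Y ⊆ ℝ³` through `0`, contained in the closed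
half-space `{⟪·, u⟫ ≤ 0}` and with points at every depth, has a site with Lennard-Jones site sum
`> 2e*` (`e* = ⨅_Q e_LJ(Q)` over periodic configurations).

This file removes `e*` from the statement.  For a level `λ` put

  `(CORE_λ)` no `1/4`-separated `Y ⊆ ℝ³` with `0 ∈ Y ⊆ {⟪·, u⟫ ≤ 0}` (`‖u‖ = 1`) and points at every
  depth has ALL its Lennard-Jones site sums `≤ −λ`.

* §14 `noThickHalfSpaceBinding_of_core_at` / registered sub-goal
  `stub_noThickHalfSpaceBinding_of_core_at` — for every `λ` with `2e* ≤ −λ`, `(CORE_λ)` implies the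
  stub VERBATIM (a counterexample to the stub has all site sums `≤ 2e* ≤ −λ`);
  `noThickHalfSpaceBinding_of_core_rung` — the kernel-level instance `λ = 711/500`
  (`two_mul_iInf_le` of part I, from the `decide`d rung `e* ≤ −0.711`);
  `noThickHalfSpaceBinding_iff_core_at_iInf` — at the level `2e*` itself `(CORE)` is the stub.
  The sharper admissible level `λ = 1435/1000` (`2e* ≤ −1.435`, twice the tree's certified window
  `OnePercentFccWindow.eStar_le`, a `native_decide` certificate) is instantiated in the separate
  computational companion `…CohesionHSharp.lean`.

`(CORE_λ)` is a pure statement about point sets and the explicit function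
`V_LJ(r) = r⁻¹²/12 − r⁻⁶/6` (no infimum over periodic configurations): sitewise positive surface
tension of Lennard-Jones matter at a free flat surface (the top layer of the hcp half-crystal is
bound at `≈ −0.99`, the bulk at `≈ −1.4352 ≈ 2e*`).  It is the open content of the stub.  Caveat for
compactness arguments on it: thickness is not preserved under local limits, and the thin (slab) case
is excluded by the tree's `noSlabBinding` only at the level `2e*`, not at a level `−λ > 2e*`.
All `[folklore]`.
-/

noncomputable section

namespace Summit.AtomisticToContinuum.Crystallization.Theorems.PerronTransitivityUniformBindingRigidity

open scoped BigOperators Topology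
open Filter Set Metric
open Literature.MathematicalPhysics.StatisticalMechanics
open Summit.AtomisticToContinuum.Crystallization.Theorems.ChargedEnergyGapNegative (E3 eStar)

/-! ## §14 The stub from its `e*`-free core -/

/-- **`(NHB-thick)` from an `e*`-free core at any admissible level.** If `2e* ≤ −λ` and no
`1/4`-separated thick half-space configuration through `0` has all its Lennard-Jones site sums
`≤ −λ`, then every such configuration has a site with site sum `> 2e*` (otherwise all site sums are
`≤ 2e* ≤ −λ`).  Kernel-checkable instance: `λ = 711/500` (`two_mul_iInf_le`, part I); certified
instance: `λ = 1435/1000` (companion file `…CohesionHSharp.lean`, computational window).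
[folklore] -/
theorem noThickHalfSpaceBinding_of_core_at {lam : ℝ}
    (hlam : 2 * (⨅ Q : PeriodicConfiguration 3, Q.energyPerParticle lennardJones) ≤ -lam)
    (CORE : ∀ (Y : Set (EuclideanSpace ℝ (Fin 3))) (u : EuclideanSpace ℝ (Fin 3)), ‖u‖ = 1 →
      (0 : EuclideanSpace ℝ (Fin 3)) ∈ Y →
      (∀ p ∈ Y, ∀ q ∈ Y, p ≠ q → 1 / 4 ≤ dist p q) →
      (∀ q ∈ Y, inner ℝ q u ≤ 0) →
      (∀ t : ℝ, ∃ q ∈ Y, inner ℝ q u < -t) →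
      (∀ p ∈ Y, ∑' q : {q : EuclideanSpace ℝ (Fin 3) // q ∈ Y ∧ q ≠ p},
          lennardJones (dist p q.1) ≤ -lam) →
      False) :
    ∀ (Y : Set (EuclideanSpace ℝ (Fin 3))) (u : EuclideanSpace ℝ (Fin 3)), ‖u‖ = 1 →
      (0 : EuclideanSpace ℝ (Fin 3)) ∈ Y →
      (∀ p ∈ Y, ∀ q ∈ Y, p ≠ q → 1 / 4 ≤ dist p q) →
      (∀ q ∈ Y, inner ℝ q u ≤ 0) →
      (∀ t : ℝ, ∃ q ∈ Y, inner ℝ q u < -t) →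
      ∃ p ∈ Y, 2 * (⨅ Q : PeriodicConfiguration 3, Q.energyPerParticle lennardJones) <
        ∑' q : {q : EuclideanSpace ℝ (Fin 3) // q ∈ Y ∧ q ≠ p}, lennardJones (dist p q.1) := by
  intro Y u hu h0 hsep hhalf hthick
  by_contra hall
  push Not at hall
  exact CORE Y u hu h0 hsep hhalf hthick fun p hp => (hall p hp).trans hlam

/-- **`(NHB-thick)` from the kernel-level core** (`λ = 711/500`, no computational certificate in
the dependency chain: `two_mul_iInf_le` of part I rests on the `decide`d rung `e* ≤ −0.711`).
[folklore] -/
theorem noThickHalfSpaceBinding_of_core_rung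
    (CORE : ∀ (Y : Set (EuclideanSpace ℝ (Fin 3))) (u : EuclideanSpace ℝ (Fin 3)), ‖u‖ = 1 →
      (0 : EuclideanSpace ℝ (Fin 3)) ∈ Y →
      (∀ p ∈ Y, ∀ q ∈ Y, p ≠ q → 1 / 4 ≤ dist p q) →
      (∀ q ∈ Y, inner ℝ q u ≤ 0) →
      (∀ t : ℝ, ∃ q ∈ Y, inner ℝ q u < -t) →
      (∀ p ∈ Y, ∑' q : {q : EuclideanSpace ℝ (Fin 3) // q ∈ Y ∧ q ≠ p},
          lennardJones (dist p q.1) ≤ -(711 / 500)) →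
      False) :
    ∀ (Y : Set (EuclideanSpace ℝ (Fin 3))) (u : EuclideanSpace ℝ (Fin 3)), ‖u‖ = 1 →
      (0 : EuclideanSpace ℝ (Fin 3)) ∈ Y →
      (∀ p ∈ Y, ∀ q ∈ Y, p ≠ q → 1 / 4 ≤ dist p q) →
      (∀ q ∈ Y, inner ℝ q u ≤ 0) →
      (∀ t : ℝ, ∃ q ∈ Y, inner ℝ q u < -t) →
      ∃ p ∈ Y, 2 * (⨅ Q : PeriodicConfiguration 3, Q.energyPerParticle lennardJones) <
        ∑' q : {q : EuclideanSpace ℝ (Fin 3) // q ∈ Y ∧ q ≠ p}, lennardJones (dist p q.1) :=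
  noThickHalfSpaceBinding_of_core_at two_mul_iInf_le CORE

/-- Conversely `(CORE)` at the level `2e*` itself is just `(NHB-thick)` restated: the two are
equivalent up to replacing `−λ` by `2e*` (recorded so the reduction loses only the gap
`2e* + λ`, `≈ −2·10⁻⁴` at the level `λ = 1435/1000` if `e* = e(hcp)`). [folklore] -/
theorem noThickHalfSpaceBinding_iff_core_at_iInf :
    (∀ (Y : Set (EuclideanSpace ℝ (Fin 3))) (u : EuclideanSpace ℝ (Fin 3)), ‖u‖ = 1 →
      (0 : EuclideanSpace ℝ (Fin 3)) ∈ Y →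
      (∀ p ∈ Y, ∀ q ∈ Y, p ≠ q → 1 / 4 ≤ dist p q) →
      (∀ q ∈ Y, inner ℝ q u ≤ 0) →
      (∀ t : ℝ, ∃ q ∈ Y, inner ℝ q u < -t) →
      ∃ p ∈ Y, 2 * (⨅ Q : PeriodicConfiguration 3, Q.energyPerParticle lennardJones) <
        ∑' q : {q : EuclideanSpace ℝ (Fin 3) // q ∈ Y ∧ q ≠ p}, lennardJones (dist p q.1)) ↔
    ∀ (Y : Set (EuclideanSpace ℝ (Fin 3))) (u : EuclideanSpace ℝ (Fin 3)), ‖u‖ = 1 →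
      (0 : EuclideanSpace ℝ (Fin 3)) ∈ Y →
      (∀ p ∈ Y, ∀ q ∈ Y, p ≠ q → 1 / 4 ≤ dist p q) →
      (∀ q ∈ Y, inner ℝ q u ≤ 0) →
      (∀ t : ℝ, ∃ q ∈ Y, inner ℝ q u < -t) →
      (∀ p ∈ Y, ∑' q : {q : EuclideanSpace ℝ (Fin 3) // q ∈ Y ∧ q ≠ p},
          lennardJones (dist p q.1) ≤
        2 * (⨅ Q : PeriodicConfiguration 3, Q.energyPerParticle lennardJones)) →
      False := by
  constructor
  · intro H Y u hu h0 hsep hhalf hthick hall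
    obtain ⟨p, hp, hlt⟩ := H Y u hu h0 hsep hhalf hthick
    exact absurd (hall p hp) (not_le.2 hlt)
  · intro H Y u hu h0 hsep hhalf hthick
    by_contra hall
    push Not at hall
    exact H Y u hu h0 hsep hhalf hthick hall

/-! ## Registered sub-goal of `stub_noThickHalfSpaceBinding`: the `e*`-free core reduction -/

/-- **Sub-goal `stub_noThickHalfSpaceBinding_of_core_at` of the stub
`stub_noThickHalfSpaceBinding`** (registered on stmt-AtomisticToContinuum-15099): for every level
`λ` with `2e* ≤ −λ`, `(CORE_λ)` implies the stub verbatim (`noThickHalfSpaceBinding_of_core_at`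
in arrow form).  Admissible levels in the tree: `711/500` (kernel) and `1435/1000` (computational
window). [folklore] -/
theorem stub_noThickHalfSpaceBinding_of_core_at :
    ∀ lam : ℝ, 2 * (⨅ Q : PeriodicConfiguration 3, Q.energyPerParticle lennardJones) ≤ -lam →
    (∀ (Y : Set (EuclideanSpace ℝ (Fin 3))) (u : EuclideanSpace ℝ (Fin 3)), ‖u‖ = 1 →
      (0 : EuclideanSpace ℝ (Fin 3)) ∈ Y →
      (∀ p ∈ Y, ∀ q ∈ Y, p ≠ q → 1 / 4 ≤ dist p q) →
      (∀ q ∈ Y, inner ℝ q u ≤ 0) →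
      (∀ t : ℝ, ∃ q ∈ Y, inner ℝ q u < -t) →
      (∀ p ∈ Y, ∑' q : {q : EuclideanSpace ℝ (Fin 3) // q ∈ Y ∧ q ≠ p},
          lennardJones (dist p q.1) ≤ -lam) →
      False) →
    ∀ (Y : Set (EuclideanSpace ℝ (Fin 3))) (u : EuclideanSpace ℝ (Fin 3)), ‖u‖ = 1 →
      (0 : EuclideanSpace ℝ (Fin 3)) ∈ Y →
      (∀ p ∈ Y, ∀ q ∈ Y, p ≠ q → 1 / 4 ≤ dist p q) →
      (∀ q ∈ Y, inner ℝ q u ≤ 0) →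
      (∀ t : ℝ, ∃ q ∈ Y, inner ℝ q u < -t) →
      ∃ p ∈ Y, 2 * (⨅ Q : PeriodicConfiguration 3, Q.energyPerParticle lennardJones) <
        ∑' q : {q : EuclideanSpace ℝ (Fin 3) // q ∈ Y ∧ q ≠ p}, lennardJones (dist p q.1) :=
  fun _ hlam CORE => noThickHalfSpaceBinding_of_core_at hlam CORE

end Summit.AtomisticToContinuum.Crystallization.Theorems.PerronTransitivityUniformBindingRigidity

end
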